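import Summits.CriticalPhenomena.PercolationContinuityZ3.Theorems.PercNearOneGluingNoHeavyLowerTailSahiLatinZeroBottomFactor

/-!
# `NoHeavyLowerTail` (crux stmt-CriticalPhenomena-4575), Sahi programme (prim-master-conj gen 50): the GENERALISED PAIRING LEMMA — the grid invariant
# `Grid4` lifts through an arbitrary UP-SET FACTOR on a private block (Harris ⟹ Hall ⟹ a downward coupling of the `S`- and `O`-weights)

Support file (`--supports stmt-CriticalPhenomena-4575`; one small definition (`edgeSet`) + proofs, no `sorry`, standard axioms; uses Mathlib's Hall
marriage theorem `Finset.all_card_le_biUnion_card_iff_exists_injective`).  Memo `run/shared/lean/prim/prim-l12/FROM-prim-master-conj-g50-GENERAL-CORE.md` §6.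
Nothing here asserts the crux, Kahn's conjecture or (C¼).

THE MATHEMATICS.  By `…ZeroBottomFactor`, for the lift `P♯ = A × P`, `b♯ = A × b`, `Q♯ = Ω × Q`, `c♯ = Ω × c` (`A ⊆ [3]^W`, `k = |W|`):
  `𝒢♯(H_SS,H_SO,H_OS,H_OO) = Σ_w 2^k[w∈A]·S(w) + Σ_w N_A(w)·O(w)`,  `S(w) = cSS(fib H_SS w) + cSO(fib H_SO w)`, `O(w) = cOS(fib H_OS w) + cOO(fib H_OO w)`,
and the `n`-dimensional invariant gives `S(a) + O(w′) ≥ 0` whenever `a ∈ A` and `w′ ≤ a` (fibres of up-sets increase with the base point, so the four fibres are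
correctly nested).  The two weight distributions have the same mass `2^k|A|` and are indexed by the same set of EDGES `E = {(a,y) : a ∈ A, y ∈ link a}`
(`S`-unit of `(a,y)` at `a`, `O`-unit at `y`); a permutation `f` of `E` with `(f e).2 ≤ e.1` (a DOWNWARD COUPLING) therefore proves `𝒢♯ ≥ 0`
(`sum_weights_nonneg_of_coupling`).  By HALL's theorem such an `f` exists iff for every down-set `D`: `2^k|A ∩ D| ≤ #{(a,y) ∈ E : y ∈ D} = N(D;A)`,
i.e. `HS(D, A) ≤ 0` — HARRIS for the up-set `A` against the down-set `D` (`HS(D,A) = −HS(Dᶜ,A) ≤ 0` by `…SahiLatinSlack.HS_nonneg`): `exists_downward_coupling`.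
Consequences: **`grid4_factorP`** / **`grid4_factorQ`** — `Grid4 P b Q c → Grid4 (A×P) (A×b) (Ω×Q) (Ω×c)` for every up-set `A` (and symmetrically on the
`Q`-side, via the `(P,b) ↔ (Q,c)` symmetry `grid4_swap`).  For `|W| = 1` these are gen 49's five pairing lemmas (`A = Ω, {2}, {1,2}`). [this work]
-/

namespace Summit.CriticalPhenomena.PercolationContinuityZ3.Theorems.SahiLatin

open Finset

/-! ## §1  Harris against a down-set -/

section harris
variable {ι : Type*} [Fintype ι] [DecidableEq ι]

/-- `HS(X, A) + HS(Xᶜ, A) = 0`: the Harris slacks of a set and its complement cancel (both count `2^d|A| − #(pairs adjacent to A)`). [this work] -/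
theorem HS_add_HS_compl (X A : Finset (Pt ι)) : HS X A + HS Xᶜ A = 0 := by
  unfold HS
  rw [sum_add_sum_compl]
  simp only [hs, sum_sub_distrib, ← mul_sum, sum_ind_eq_card_inter, univ_inter, sum_N_comm univ A]
  have : ∀ a ∈ A, (N (univ : Finset (Pt ι)) a : ℤ) = 2 ^ Fintype.card ι := by
    intro a _; rw [N, filter_true_of_mem fun y _ => mem_univ y, card_link]; push_cast; rfl
  rw [sum_congr rfl this, sum_const, nsmul_eq_mul]; ring

/-- **Harris against a down-set**: if `Dᶜ` and `A` are up-sets then `HS(D, A) ≤ 0`, i.e. `2^d·|D ∩ A| ≤ N(D; A)`. [this work] -/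
theorem HS_nonpos_of_compl_upper {D A : Finset (Pt ι)} (hD : IsUpperSet ((Dᶜ : Finset (Pt ι)) : Set (Pt ι))) (hA : IsUpperSet (A : Set (Pt ι))) :
    HS D A ≤ 0 := by
  have h := HS_add_HS_compl D A
  have h' := HS_nonneg hD hA
  linarith

end harris

/-! ## §2  The edge set and the downward coupling -/

section coupling
variable {W : Type*} [Fintype W] [DecidableEq W]

/-- The EDGE SET of `A`: pairs `(a, y)` with `a ∈ A` and `y` in the link of `a`. [this work] -/
def edgeSet (A : Finset (Pt W)) : Finset (Pt W × Pt W) := (A ×ˢ univ).filter fun e => e.2 ∈ link e.1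

/-- Membership in the edge set. [this work] -/
@[simp] theorem mem_edgeSet {A : Finset (Pt W)} {e : Pt W × Pt W} : e ∈ edgeSet A ↔ e.1 ∈ A ∧ e.2 ∈ link e.1 := by
  simp [edgeSet]

/-- `S`-weights: `Σ_{e ∈ E} g(e.1) = Σ_w 2^k [w∈A] g(w)`. [this work] -/
theorem sum_edgeSet_fst (A : Finset (Pt W)) (g : Pt W → ℤ) :
    ∑ e ∈ edgeSet A, g e.1 = ∑ w, 2 ^ Fintype.card W * ind A w * g w := by
  rw [edgeSet, sum_filter, sum_product]
  rw [← sum_add_sum_compl A (fun w => 2 ^ Fintype.card W * ind A w * g w)]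
  have hz : ∑ w ∈ Aᶜ, 2 ^ Fintype.card W * ind A w * g w = 0 :=
    sum_eq_zero fun w hw => by rw [mem_compl] at hw; simp [ind_of_not_mem hw]
  rw [hz, add_zero]
  refine sum_congr rfl fun a ha => ?_
  have hs : (univ.filter fun y : Pt W => (a, y).2 ∈ link (a, y).1) = link a := by ext y; simp
  rw [← sum_filter, hs]
  show ∑ _y ∈ link a, g a = _
  rw [sum_const, card_link, nsmul_eq_mul, ind_of_mem ha]
  push_cast; ring

/-- `O`-weights: `Σ_{e ∈ E} g(e.2) = Σ_w N_A(w) g(w)`. [this work] -/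
theorem sum_edgeSet_snd (A : Finset (Pt W)) (g : Pt W → ℤ) :
    ∑ e ∈ edgeSet A, g e.2 = ∑ w, (N A w : ℤ) * g w := by
  rw [edgeSet, sum_filter, sum_product, sum_comm]
  refine sum_congr rfl fun y _ => ?_
  rw [N_eq_sum_boole, sum_mul]
  refine sum_congr rfl fun a _ => ?_
  by_cases h : y ∈ link a
  · simp [h, mem_link_comm.1 h]
  · have h' : a ∉ link y := fun h' => h (mem_link_comm.1 h')
    simp [h, h']

/-- Edges with first vertex in `D`: `#{(a,y) ∈ E : a ∈ D} = 2^k·|D ∩ A|`. [this work] -/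
theorem card_edgeSet_fst_mem (A D : Finset (Pt W)) :
    (((edgeSet A).filter fun e => e.1 ∈ D).card : ℤ) = 2 ^ Fintype.card W * (D ∩ A).card := by
  have h := sum_edgeSet_fst A (fun w => if w ∈ D then 1 else 0)
  rw [← sum_filter, sum_const, nsmul_eq_mul, mul_one] at h
  rw [h, ← sum_ind_eq_card_inter, mul_sum]
  rw [← sum_add_sum_compl D]
  have hz : ∑ w ∈ Dᶜ, (2 ^ Fintype.card W * ind A w * if w ∈ D then (1 : ℤ) else 0) = 0 :=
    sum_eq_zero fun w hw => by rw [mem_compl] at hw; simp [hw]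
  rw [hz, add_zero]
  exact sum_congr rfl fun w hw => by simp [hw]

/-- Edges with second vertex in `D`: `#{(a,y) ∈ E : y ∈ D} = N(D; A)`. [this work] -/
theorem card_edgeSet_snd_mem (A D : Finset (Pt W)) :
    (((edgeSet A).filter fun e => e.2 ∈ D).card : ℤ) = latinPairs D A := by
  have h := sum_edgeSet_snd A (fun w => if w ∈ D then 1 else 0)
  rw [← sum_filter, sum_const, nsmul_eq_mul, mul_one] at h
  rw [h, ← sum_N_eq_latinPairs, ← sum_add_sum_compl D]
  have hz : ∑ w ∈ Dᶜ, ((N A w : ℤ) * if w ∈ D then (1 : ℤ) else 0) = 0 :=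
    sum_eq_zero fun w hw => by rw [mem_compl] at hw; simp [hw]
  rw [hz, add_zero]
  exact sum_congr rfl fun w hw => by simp [hw]

/-- **The downward coupling** (Harris ⟹ Hall): for an up-set `A` there is a permutation `f` of the edge set with `(f e).2 ≤ e.1`. [this work] -/
theorem exists_downward_coupling (A : Finset (Pt W)) (hA : IsUpperSet (A : Set (Pt W))) :
    ∃ f : {e // e ∈ edgeSet A} → Pt W × Pt W, Function.Injective f ∧ ∀ x, f x ∈ edgeSet A ∧ (f x).2 ≤ x.1.1 := by
  classical
  let t : {e // e ∈ edgeSet A} → Finset (Pt W × Pt W) := fun x => (edgeSet A).filter fun e => e.2 ≤ x.1.1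
  have hall : ∀ s : Finset {e // e ∈ edgeSet A}, s.card ≤ (s.biUnion t).card := by
    intro s
    -- the down-closure of the first vertices of `s`
    let D : Finset (Pt W) := univ.filter fun w => ∃ x ∈ s, w ≤ x.1.1
    have hDc : IsUpperSet ((Dᶜ : Finset (Pt W)) : Set (Pt W)) := by
      intro w w' hww' hw
      rw [mem_coe, mem_compl] at hw ⊢
      intro hw'
      apply hw
      simp only [D, mem_filter, mem_univ, true_and] at hw' ⊢
      obtain ⟨x, hx, hle⟩ := hw'
      exact ⟨x, hx, hww'.trans hle⟩
    -- |s| ≤ #{e ∈ E : e.1 ∈ D}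
    have h1 : s.card ≤ ((edgeSet A).filter fun e => e.1 ∈ D).card := by
      have : s.card = (s.map (Function.Embedding.subtype _)).card := (card_map _).symm
      rw [this]
      refine card_le_card fun e he => ?_
      rw [mem_map] at he
      obtain ⟨x, hx, rfl⟩ := he
      rw [mem_filter]
      refine ⟨x.2, ?_⟩
      simp only [D, mem_filter, mem_univ, true_and, Function.Embedding.coe_subtype]
      exact ⟨x, hx, le_rfl⟩
    -- s.biUnion t = {e ∈ E : e.2 ∈ D}
    have h2 : s.biUnion t = (edgeSet A).filter fun e => e.2 ∈ D := by
      ext e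
      simp only [mem_biUnion, t, D, mem_filter, mem_univ, true_and]
      constructor
      · rintro ⟨x, hx, he, hle⟩; exact ⟨he, x, hx, hle⟩
      · rintro ⟨he, x, hx, hle⟩; exact ⟨x, hx, he, hle⟩
    rw [h2]
    have h3 : (((edgeSet A).filter fun e => e.1 ∈ D).card : ℤ) ≤ (((edgeSet A).filter fun e => e.2 ∈ D).card : ℤ) := by
      rw [card_edgeSet_fst_mem, card_edgeSet_snd_mem]
      have := HS_nonpos_of_compl_upper hDc hA
      rw [HS_eq] at this
      linarith
    exact_mod_cast h1.trans (by exact_mod_cast h3)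
  obtain ⟨f, hf, hft⟩ := (all_card_le_biUnion_card_iff_exists_injective t).1 hall
  refine ⟨f, hf, fun x => ?_⟩
  have := hft x
  simp only [t, mem_filter] at this
  exact this

/-- **Weighted sums under a downward coupling**: if `S(a) + O(w′) ≥ 0` whenever `a ∈ A`, `w′ ≤ a`, then
`Σ_w 2^k[w∈A]·S(w) + Σ_w N_A(w)·O(w) ≥ 0` (for an up-set `A`). [this work] -/
theorem sum_weights_nonneg_of_coupling (A : Finset (Pt W)) (hA : IsUpperSet (A : Set (Pt W))) (S O : Pt W → ℤ)
    (h : ∀ a ∈ A, ∀ w', w' ≤ a → 0 ≤ S a + O w') :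
    0 ≤ ∑ w, 2 ^ Fintype.card W * ind A w * S w + ∑ w, (N A w : ℤ) * O w := by
  classical
  obtain ⟨f, hf, hfE⟩ := exists_downward_coupling A hA
  rw [← sum_edgeSet_fst, ← sum_edgeSet_snd]
  -- the image of `f` is the whole edge set
  have himg : (univ : Finset {e // e ∈ edgeSet A}).image f = edgeSet A := by
    apply eq_of_subset_of_card_le
    · intro e he
      rw [mem_image] at he
      obtain ⟨x, _, rfl⟩ := he
      exact (hfE x).1
    · rw [card_image_of_injective _ hf, card_univ, Fintype.card_coe]
  have hO : ∑ e ∈ edgeSet A, O e.2 = ∑ x : {e // e ∈ edgeSet A}, O (f x).2 := by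
    have h1 : ∑ e ∈ (univ : Finset {e // e ∈ edgeSet A}).image f, O e.2 = ∑ x : {e // e ∈ edgeSet A}, O (f x).2 :=
      sum_image fun x _ y _ hxy => hf hxy
    rw [himg] at h1
    exact h1
  have hS : ∑ e ∈ edgeSet A, S e.1 = ∑ x : {e // e ∈ edgeSet A}, S x.1.1 := (sum_coe_sort (edgeSet A) (fun e => S e.1)).symm
  rw [hO, hS, ← sum_add_distrib]
  refine sum_nonneg fun x _ => h _ ?_ _ (hfE x).2
  exact (mem_edgeSet.1 x.2).1

end coupling

/-! ## §3  The generalised pairing lemmas -/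

section pairing
variable {W κ : Type} [Fintype W] [DecidableEq W] [Fintype κ] [DecidableEq κ]

/-- **GENERALISED PAIRING LEMMA (P-side factor)**: `Grid4` lifts through an arbitrary up-set factor `A ⊆ [3]^W` on a private block:
`Grid4 P b Q c → Grid4 (A × P) (A × b) (Ω × Q) (Ω × c)`. [this work] -/
theorem grid4_factorP {A : Finset (Pt W)} (hA : IsUpperSet (A : Set (Pt W))) {P b Q c : Finset (Pt κ)} (h : Grid4 P b Q c) :
    Grid4 ((cylL A : Finset (Pt (W ⊕ κ))) ∩ cylR P) (cylL A ∩ cylR b) (cylR Q) (cylR c) := by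
  intro HSS HSO HOS HOO u1 u2 u3 u4 n1 n2 n3 n4 f1 f2 f3
  rw [cSS_factor, cSO_factor, cOS_factor, cOO_factor]
  have e : ∑ w, 2 ^ Fintype.card W * ind A w * cSS (fib HSS w) P b Q c + ∑ w, 2 ^ Fintype.card W * ind A w * cSO (fib HSO w) P b Q c
      + ∑ w, (N A w : ℤ) * cOS (fib HOS w) P b Q c + ∑ w, (N A w : ℤ) * cOO (fib HOO w) P b Q c
      = ∑ w, 2 ^ Fintype.card W * ind A w * (cSS (fib HSS w) P b Q c + cSO (fib HSO w) P b Q c)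
        + ∑ w, (N A w : ℤ) * (cOS (fib HOS w) P b Q c + cOO (fib HOO w) P b Q c) := by
    simp only [mul_add, sum_add_distrib]; ring
  rw [e]
  refine sum_weights_nonneg_of_coupling A hA _ _ fun a ha w' hw => ?_
  have hP : P ⊆ fib HSS a := subset_fib_of_prod_subset ((subset_union_left).trans f1) ha
  have hQ : Q ⊆ fib HSS a := subset_fib_of_cylR_subset ((subset_union_right).trans f1) a
  have key := h (fib HSS a) (fib HSO a) (fib HOS w') (fib HOO w') (isUpperSet_fib u1 a) (isUpperSet_fib u2 a) (isUpperSet_fib u3 w')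
    (isUpperSet_fib u4 w') ((fib_subset_fib n1 w').trans (fib_mono u2 hw)) (fib_subset_fib n2 w') (fib_subset_fib n3 a)
    ((fib_subset_fib n4 w').trans (fib_mono u1 hw)) (union_subset hP hQ) (subset_fib_of_prod_subset f2 ha) (subset_fib_of_cylR_subset f3 w')
  linarith

/-- `latinTriples` is symmetric in its last two arguments. [this work] -/
theorem latinTriples_swap23 (H s t : Finset (Pt κ)) : latinTriples H s t = latinTriples H t s := by
  rw [latinTriples_eq_sum_Lam, latinTriples_eq_sum_Lam]
  exact sum_congr rfl fun u _ => by rw [Lam_comm]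

/-- `(P,b) ↔ (Q,c)` symmetry of `cSS`. [this work] -/
theorem cSS_swap (H P b Q c : Finset (Pt κ)) : cSS H Q c P b = cSS H P b Q c := by
  unfold cSS; rw [inter_right_comm H c b]; ring

/-- `(P,b) ↔ (Q,c)` symmetry of `cOO`. [this work] -/
theorem cOO_swap (H P b Q c : Finset (Pt κ)) : cOO H Q c P b = cOO H P b Q c := by
  unfold cOO; rw [latinTriples_swap23 H Q b, latinTriples_swap23 H c P, latinTriples_swap23 H c b, inter_comm c b]; ring

/-- **`Grid4` is symmetric under `(P,b) ↔ (Q,c)`** (the `SO` and `OS` parts trade places). [this work] -/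
theorem grid4_swap {P b Q c : Finset (Pt κ)} (h : Grid4 P b Q c) : Grid4 Q c P b := by
  intro HSS HSO HOS HOO u1 u2 u3 u4 n1 n2 n3 n4 f1 f2 f3
  have key := h HSS HOS HSO HOO u1 u3 u2 u4 n2 n1 n4 n3 (by rwa [union_comm]) f3 f2
  rw [cSS_swap, cOO_swap]
  show 0 ≤ cSS HSS P b Q c + cOS HSO P b Q c + cSO HOS P b Q c + cOO HOO P b Q c
  linarith

/-- **GENERALISED PAIRING LEMMA (Q-side factor)**: `Grid4 P b Q c → Grid4 (Ω × P) (Ω × b) (B × Q) (B × c)` for every up-set `B ⊆ [3]^W`. [this work] -/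
theorem grid4_factorQ {B : Finset (Pt W)} (hB : IsUpperSet (B : Set (Pt W))) {P b Q c : Finset (Pt κ)} (h : Grid4 P b Q c) :
    Grid4 (cylR P : Finset (Pt (W ⊕ κ))) (cylR b) (cylL B ∩ cylR Q) (cylL B ∩ cylR c) :=
  grid4_swap (grid4_factorP hB (grid4_swap h))

end pairing

end Summit.CriticalPhenomena.PercolationContinuityZ3.Theorems.SahiLatin
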